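import Literature.IUT.HodgeArakelov.MonoThetaProjDataNonVacuity
import Literature.IUT.HodgeArakelov.MonoThetaProjectiveChainProofs

/-!
# [IUTchII] Definition 2.7 (i) / Proposition 1.5 (iii): the inverse limit `Π_{M^Θ_*}` SURJECTS onto every
# member `Π_{M^Θ_M}` — the printed image clause «whose image is the subgroup … determined by `Π^tp_{Y_v}`»
# and «`Π_μ(M^Θ_*) ↠ Π_μ(M^Θ_M)`» as kernel theorems (Mittag-Leffler along `(ℕ_{≥1}, ∣)`)

Proof-only companion (abc-iut cell, layer L6, zone holder abc-iut-L6-t1 gen 4 of [IUTchII] §1–§2; nodes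
**IUTchII:Def2.7(i)** and **IUTchII:Prop1.5(iii)**) of abc-iut-L6-t1's statement file `MonoThetaProjective.lean`
(p407497: `MonoThetaProjSystem`, `extCycLim`), of abc-iut-L6-t2's `ThetaEvaluationSubgraphs.lean` (p404618:
`MonoThetaProjData`) and of the non-vacuity record `MonoThetaProjDataNonVacuity.lean`
(`MonoThetaProjData.exists_model_system`). NO definition, NO instance, NO named fact; nothing is restated.

S. Mochizuki, *Inter-universal Teichmüller theory II*, kurims manuscript (Dec. 2020) [claim key `Mochizuki2012`,
status DISPUTED (D-0012)], read on the cell render `lit/renders/IUTchII-kurims-url-5036b4059555`: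
* Def. 2.7 (i), p. 81 l. 4–12: "Write `Π_{M^Θ_*}` for the inverse limit of the induced projective system of
  topological groups `{… → Π_{M^Θ_{M'}} → Π_{M^Θ_M} → …}` … Thus, [in the notation of Proposition 1.5] we have a
  natural homomorphism of topological groups `Π_{M^Θ_*} → Π_X(M^Θ_*)` whose kernel may be identified with the
  exterior cyclotome `Π_μ(M^Θ_*)`, and whose image is the subgroup of `Π_X(M^Θ_*) ≅ Π_v` determined by `Π^tp_{Y_v}`."
* Prop. 1.5 (iii), p. 29: "The projective system of exterior cyclotomes `{… → Π_μ(M^Θ_{M'}) → Π_μ(M^Θ_M) → …}`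
  determines a projective limit exterior cyclotome `Π_μ(M^Θ_*)`".

WHAT WAS MISSING. `MonoThetaProjData.exists_model_system` realises `Π_{M^Θ_*}` as the group of compatible
families `{x ∈ ∏_M Π_{M^Θ_M} | trans (x M') = x M}` with `proj` the member-`1` projection to
`Π_X(M^Θ_*) := Π_X(M^Θ_1)`, and PROVES the kernel clause; its image entry is `PiY := proj.range` BY DEFINITION.
The printed image clause says more: the image IS `Π_Y(M^Θ_1) ⊆ Π_X(M^Θ_1)`, i.e. the limit SURJECTS onto
`Π_{M^Θ_1}` (then onto `Π_Y(M^Θ_1)` by `projY_surjective`). That surjectivity is the elementary Mittag-Leffler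
step for a projective system of SURJECTIONS indexed by the countable directed set `(ℕ_{≥1}, ∣)`: dependent
choice along the cofinal chain `M₀ ∣ M₀·1! ∣ M₀·2! ∣ …`, extended to every index `M ∣ M₀·M!` by the transition
maps. Surjectivity of the transitions is exactly what the REPAIRED Prop. 1.5 (i) hypothesis
`MonoThetaProjSystem.IsMonoThetaCompatible R` ("the transitions are morphisms of mono-theta environments",
[EtTh] Def. 2.13 (ii)) supplies BY NAME (`trans_surjective_of_isMonoThetaCompatible`, abc-iut-w4-d030,
`MonoThetaProjectiveChainProofs.lean`).

WHAT IS PROVED (pure group theory over the interfaces):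
* `MonoThetaProjSystem.exists_compatible_eq` — with surjective transitions, every `a ∈ Π_{M^Θ_{M₀}}` is the
  `M₀`-member of a compatible family (the limit surjects onto every member);
* `MonoThetaProjSystem.evalCompatible_surjective` — the same for the member-`M₀` projection from the subgroup of
  compatible families used verbatim in `MonoThetaProjData.exists_model_system`;
* `MonoThetaProjSystem.range_def27iProj_eq` — Def. 2.7 (i): the natural homomorphism
  `Π_{M^Θ_*} → Π_X(M^Θ_*)` has image EXACTLY `Π_Y(M^Θ_1) = (Sys.recon 1).inclY.range`;
  `MonoThetaProjData.exists_model_system_image` — the Def. 2.7 (i) datum with `PiY = Π_Y(M^Θ_1)` ON THE NOSE;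
* `MonoThetaProjSystem.trans_mem_extCyc` / `mem_extCyc_of_trans_mem_extCyc` — the transitions carry `Π_μ` into
  `Π_μ`, and (for injective `Π_X`-transitions, Prop. 1.5 (ii)) an element whose transition lies in `Π_μ` lies in
  `Π_μ`;
* `MonoThetaProjSystem.map_eval_extCycLim_eq` — Prop. 1.5 (iii): `Π_μ(M^Θ_*) = extCycLim` maps ONTO
  `Π_μ(M^Θ_{M₀})` for every `M₀` (surjective transitions + injective `Π_X`-transitions);
* `…_of_isMonoThetaCompatible` forms: the same with the hypotheses of record `IsMonoThetaCompatible R` and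
  `transitionsAreIsos` BY NAME.

HONEST SCOPE: topologies are not used (the compatible-family group carries none here, as in the NV record); the
identification `Π_Y(M^Θ_1) ↔ Π^tp_{Y_v}` is the Def. 1.1 (i) field `Reconstruction.projG_corresponds` lineage
(edge, not touched). Typed ≠ endorsed; no side taken on [IUTchIII] Cor. 3.12; nothing here asserts abc proved or
refuted.
-/

namespace Literature.IUT.HodgeArakelov

universe u

variable {S : ThetaSetting.{u}} {F : ModelFamily S}

namespace MonoThetaProjSystem

variable (Sys : MonoThetaProjSystem F)

/-! ### 1. The Mittag-Leffler step: the limit surjects onto every member -/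

/-- **IUTchII:Def2.7(i)** (kurims p. 81 l. 4–12, "the inverse limit … `Π_{M^Θ_*}`") — the elementary
Mittag-Leffler step along the countable directed set `(ℕ_{≥1}, ∣)`: if every transition
`Π_{M^Θ_{M'}} → Π_{M^Θ_M}` is surjective, then every element `a ∈ Π_{M^Θ_{M₀}}` is the `M₀`-member of a
COMPATIBLE family `x ∈ ∏_M Π_{M^Θ_M}` (dependent choice along the cofinal chain `M₀·k!`, `k = 0, 1, 2, …`,
then transport to every `M ∣ M₀·M!`). [claim: Mochizuki2012, status: disputed]
[cite: Mochizuki2012, Def 2.7 (i) p.81] -/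
theorem exists_compatible_eq
    (hsurj : ∀ {M M' : ℕ+} (h : (M : ℕ) ∣ (M' : ℕ)), Function.Surjective (Sys.trans h))
    (M₀ : ℕ+) (a : (Sys.env M₀).Pi) :
    ∃ x : ∀ M : ℕ+, (Sys.env M).Pi,
      (∀ (M M' : ℕ+) (h : (M : ℕ) ∣ (M' : ℕ)), Sys.trans h (x M') = x M) ∧ x M₀ = a := by
  classical
  -- the cofinal chain `N k := M₀ · k!`
  let N : ℕ → ℕ+ := fun k => M₀ * ⟨k.factorial, Nat.factorial_pos k⟩
  have hN : ∀ k, ((N k : ℕ+) : ℕ) = (M₀ : ℕ) * k.factorial := fun k => by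
    simp [N, PNat.mul_coe]
  have hle : ∀ {k n : ℕ}, k ≤ n → ((N k : ℕ+) : ℕ) ∣ ((N n : ℕ+) : ℕ) := fun {k n} hkn => by
    rw [hN, hN]
    exact mul_dvd_mul_left _ (Nat.factorial_dvd_factorial hkn)
  have hstep : ∀ k, ((N k : ℕ+) : ℕ) ∣ ((N (k + 1) : ℕ+) : ℕ) := fun k => hle (Nat.le_succ k)
  have h0 : (M₀ : ℕ) ∣ ((N 0 : ℕ+) : ℕ) := by
    rw [hN]
    exact dvd_mul_right _ _
  -- dependent choice along the chain
  let y : ∀ k, (Sys.env (N k)).Pi := fun k =>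
    Nat.rec (motive := fun k => (Sys.env (N k)).Pi) (Classical.choose (hsurj h0 a))
      (fun k yk => Classical.choose (hsurj (hstep k) yk)) k
  have hy0 : Sys.trans h0 (y 0) = a := Classical.choose_spec (hsurj h0 a)
  have hysucc : ∀ k, Sys.trans (hstep k) (y (k + 1)) = y k := fun k =>
    Classical.choose_spec (hsurj (hstep k) (y k))
  -- compatibility along the chain
  have hchain : ∀ (k n : ℕ) (hkn : k ≤ n) (h : ((N k : ℕ+) : ℕ) ∣ ((N n : ℕ+) : ℕ)),
      Sys.trans h (y n) = y k := by
    intro k n hkn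
    induction n, hkn using Nat.le_induction with
    | base => intro h; exact Sys.trans_refl _ _
    | succ n hkn ih =>
      intro h
      rw [show Sys.trans h (y (n + 1)) = Sys.trans (hle hkn) (Sys.trans (hstep n) (y (n + 1))) from
        (Sys.trans_comp (hle hkn) (hstep n) (y (n + 1))).symm, hysucc n]
      exact ih (hle hkn)
  -- every index divides a chain member: `M ∣ M₀ · M!`
  have hM : ∀ M : ℕ+, (M : ℕ) ∣ ((N (M : ℕ) : ℕ+) : ℕ) := fun M => by
    rw [hN]
    exact Dvd.dvd.mul_left (Nat.dvd_factorial M.pos le_rfl) _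
  refine ⟨fun M => Sys.trans (hM M) (y (M : ℕ)), fun M M' h => ?_, ?_⟩
  · -- compatibility: both sides are the transport of `y M'` from `N M'`
    have hMM' : (M : ℕ) ≤ (M' : ℕ) := Nat.le_of_dvd M'.pos h
    show Sys.trans h (Sys.trans (hM M') (y (M' : ℕ))) = Sys.trans (hM M) (y (M : ℕ))
    rw [Sys.trans_comp, ← hchain (M : ℕ) (M' : ℕ) hMM' (hle hMM'), Sys.trans_comp]
  · -- the `M₀`-member is `a`
    have h0M : 0 ≤ (M₀ : ℕ) := Nat.zero_le _
    show Sys.trans (hM M₀) (y (M₀ : ℕ)) = a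
    -- `a = trans_{M₀ ∣ N 0} (y 0) = trans_{M₀ ∣ N M₀} (y M₀)`, up to the (irrelevant) divisibility proofs
    rw [← hy0, ← hchain 0 (M₀ : ℕ) h0M (hle h0M), Sys.trans_comp]

/-- **IUTchII:Def2.7(i)** (kurims p. 81): with surjective transitions, the member-`M₀` projection from the
group of compatible families `{x ∈ ∏_M Π_{M^Θ_M} | trans (x M') = x M}` (the realisation of `Π_{M^Θ_*}` used in
`MonoThetaProjData.exists_model_system`, written as the same infimum of equaliser subgroups) is SURJECTIVE onto
`Π_{M^Θ_{M₀}}`. [claim: Mochizuki2012, status: disputed] [cite: Mochizuki2012, Def 2.7 (i) p.81] -/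
theorem evalCompatible_surjective
    (hsurj : ∀ {M M' : ℕ+} (h : (M : ℕ) ∣ (M' : ℕ)), Function.Surjective (Sys.trans h)) (M₀ : ℕ+) :
    Function.Surjective
      ((Pi.evalMonoidHom (fun N : ℕ+ => (Sys.env N).Pi) M₀).comp
        (Subgroup.subtype
          (⨅ (M : ℕ+) (M' : ℕ+) (hd : (M : ℕ) ∣ (M' : ℕ)),
            MonoidHom.eqLocus ((Sys.trans hd).comp (Pi.evalMonoidHom (fun N : ℕ+ => (Sys.env N).Pi) M'))
              (Pi.evalMonoidHom (fun N : ℕ+ => (Sys.env N).Pi) M) :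
                Subgroup (∀ N : ℕ+, (Sys.env N).Pi)))) := by
  intro a
  obtain ⟨x, hx, hxa⟩ := Sys.exists_compatible_eq hsurj M₀ a
  refine ⟨⟨x, ?_⟩, hxa⟩
  simp only [Subgroup.mem_iInf]
  intro M M' hd
  exact hx M M' hd

/-! ### 2. Def. 2.7 (i): the image of `Π_{M^Θ_*} → Π_X(M^Θ_*)` IS `Π_Y(M^Θ_1)` -/

/-- **IUTchII:Def2.7(i)** (kurims p. 81 l. 9–12, "whose image is the subgroup of `Π_X(M^Θ_*) ≅ Π_v` determined
by `Π^tp_{Y_v}`"): for a projective system of mono-theta environments with surjective transitions, the natural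
homomorphism `Π_{M^Θ_*} → Π_X(M^Θ_*)` — the member-`1` projection followed by `Π_{M^Θ_1} ↠ Π_Y(M^Θ_1) ⊆ Π_X(M^Θ_1)`
(Def. 1.1 (i)) — has image EXACTLY `Π_Y(M^Θ_1) = range inclY`. PROVED (the limit surjects onto `Π_{M^Θ_1}`,
`projY` is onto). [claim: Mochizuki2012, status: disputed] [cite: Mochizuki2012, Def 2.7 (i) p.81] -/
theorem range_def27iProj_eq
    (hsurj : ∀ {M M' : ℕ+} (h : (M : ℕ) ∣ (M' : ℕ)), Function.Surjective (Sys.trans h)) :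
    (((Sys.recon 1).inclY.comp (Sys.recon 1).projY).comp
        ((Pi.evalMonoidHom (fun N : ℕ+ => (Sys.env N).Pi) 1).comp
          (Subgroup.subtype
            (⨅ (M : ℕ+) (M' : ℕ+) (hd : (M : ℕ) ∣ (M' : ℕ)),
              MonoidHom.eqLocus ((Sys.trans hd).comp (Pi.evalMonoidHom (fun N : ℕ+ => (Sys.env N).Pi) M'))
                (Pi.evalMonoidHom (fun N : ℕ+ => (Sys.env N).Pi) M) :
                  Subgroup (∀ N : ℕ+, (Sys.env N).Pi))))).range =
      (Sys.recon 1).inclY.range := by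
  rw [MonoidHom.range_comp, MonoidHom.range_eq_top.mpr (Sys.evalCompatible_surjective hsurj 1),
    ← MonoidHom.range_eq_map, MonoidHom.range_comp,
    MonoidHom.range_eq_top.mpr (Sys.recon 1).projY_surjective, ← MonoidHom.range_eq_map]

/-- **IUTchII:Def2.7(i)** under the hypothesis of record (REPAIRED Prop. 1.5 (i), `IsMonoThetaCompatible R`:
the transitions are morphisms of mono-theta environments, hence surjective —
`trans_surjective_of_isMonoThetaCompatible`): the image of `Π_{M^Θ_*} → Π_X(M^Θ_*)` is `Π_Y(M^Θ_1)`.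
[claim: Mochizuki2012, status: disputed] [cite: Mochizuki2012, Def 2.7 (i) p.81] -/
theorem range_def27iProj_eq_of_isMonoThetaCompatible (R : F.Reductions)
    (hSys : Sys.IsMonoThetaCompatible R) :
    (((Sys.recon 1).inclY.comp (Sys.recon 1).projY).comp
        ((Pi.evalMonoidHom (fun N : ℕ+ => (Sys.env N).Pi) 1).comp
          (Subgroup.subtype
            (⨅ (M : ℕ+) (M' : ℕ+) (hd : (M : ℕ) ∣ (M' : ℕ)),
              MonoidHom.eqLocus ((Sys.trans hd).comp (Pi.evalMonoidHom (fun N : ℕ+ => (Sys.env N).Pi) M'))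
                (Pi.evalMonoidHom (fun N : ℕ+ => (Sys.env N).Pi) M) :
                  Subgroup (∀ N : ℕ+, (Sys.env N).Pi))))).range =
      (Sys.recon 1).inclY.range :=
  Sys.range_def27iProj_eq fun h => trans_surjective_of_isMonoThetaCompatible R Sys hSys h

end MonoThetaProjSystem

namespace MonoThetaProjData

/-- **IUTchII:Def2.7(i)** (kurims p. 81), the Def. 2.7 (i) datum over a projective system of mono-theta
environments WITH ITS PRINTED IMAGE: for `Sys : MonoThetaProjSystem F` with surjective transitions and supplied
`Π_{v¨▶} ≤ Π_{v▶} ⊆ Π_X(M^Θ_*)` (Def. 2.3 (ii)), the datum of `exists_model_system` (compatible families,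
member-`1` projection) exists with image entry `PiY = Π_Y(M^Θ_1) = range inclY` ON THE NOSE — "whose image is
the subgroup of `Π_X(M^Θ_*) ≅ Π_v` determined by `Π^tp_{Y_v}`" — and with the Prop. 1.5 (iii) limit exterior
cyclotome inside its kernel ("whose kernel may be identified with the exterior cyclotome", the equality being
`exists_model_system`). [claim: Mochizuki2012, status: disputed] [cite: Mochizuki2012, Def 2.7 (i) p.81] -/
theorem exists_model_system_image (Sys : MonoThetaProjSystem F)
    (hsurj : ∀ {M M' : ℕ+} (h : (M : ℕ) ∣ (M' : ℕ)), Function.Surjective (Sys.trans h))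
    (D DD : Subgroup Sys.PiX) (h : DD ≤ D) :
    ∃ X : MonoThetaProjData
        (⨅ (M : ℕ+) (M' : ℕ+) (hd : (M : ℕ) ∣ (M' : ℕ)),
          MonoidHom.eqLocus ((Sys.trans hd).comp (Pi.evalMonoidHom (fun N : ℕ+ => (Sys.env N).Pi) M'))
            (Pi.evalMonoidHom (fun N : ℕ+ => (Sys.env N).Pi) M) : Subgroup (∀ N : ℕ+, (Sys.env N).Pi))
        Sys.PiX,
      X.proj = ((Sys.recon 1).inclY.comp (Sys.recon 1).projY).comp
          ((Pi.evalMonoidHom (fun N : ℕ+ => (Sys.env N).Pi) 1).comp (Subgroup.subtype _)) ∧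
      X.PivD = D ∧ X.PivDD = DD ∧ X.PiY = (Sys.recon 1).inclY.range ∧
      Sys.extCycLim ≤ X.exteriorCyclotome.map (Subgroup.subtype _) := by
  refine ⟨⟨((Sys.recon 1).inclY.comp (Sys.recon 1).projY).comp
      ((Pi.evalMonoidHom (fun N : ℕ+ => (Sys.env N).Pi) 1).comp (Subgroup.subtype _)),
    D, DD, h, (Sys.recon 1).inclY.range, Sys.range_def27iProj_eq hsurj⟩, rfl, rfl, rfl, rfl, ?_⟩
  -- `Π_μ(M^Θ_*) ⊆ Ker(proj)` (as in `exists_model_system`)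
  rintro x ⟨hx, hx'⟩
  refine ⟨⟨x, ?_⟩, ?_, rfl⟩
  · simp only [Subgroup.mem_iInf]
    intro M M' hd
    exact hx' M M' hd
  · have h1 : (Sys.recon 1).projY (x 1) = 1 := hx 1
    show (Sys.recon 1).inclY ((Sys.recon 1).projY (x 1)) = 1
    rw [h1, map_one]

end MonoThetaProjData

namespace MonoThetaProjSystem

variable (Sys : MonoThetaProjSystem F)

/-! ### 3. Prop. 1.5 (iii): `Π_μ(M^Θ_*) ↠ Π_μ(M^Θ_M)` -/

/-- **IUTchII:Prop1.5(iii)** (kurims p. 29, "the projective system of exterior cyclotomes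
`{… → Π_μ(M^Θ_{M'}) → Π_μ(M^Θ_M) → …}`"): the transitions carry `Π_μ(M^Θ_{M'}) = Ker(Π_{M^Θ_{M'}} ↠ Π_Y)` into
`Π_μ(M^Θ_M)` (by `transX_compat` and injectivity of `inclY`). [claim: Mochizuki2012, status: disputed]
[cite: Mochizuki2012, Prop 1.5 (iii) p.29] -/
theorem trans_mem_extCyc {M M' : ℕ+} (h : (M : ℕ) ∣ (M' : ℕ)) {z : (Sys.env M').Pi}
    (hz : z ∈ (Sys.recon M').extCyc) : Sys.trans h z ∈ (Sys.recon M).extCyc := by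
  rw [Reconstruction.extCyc, MonoidHom.mem_ker] at hz ⊢
  apply (Sys.recon M).inclY_isOpenEmbedding.injective
  rw [← Sys.transX_compat h z, hz, map_one, map_one, map_one]

/-- **IUTchII:Prop1.5(ii)⇒(iii)** (kurims p. 29): if the `Π_X`-transition `Π_X(M^Θ_{M'}) → Π_X(M^Θ_M)` is injective
(first clause of Prop. 1.5 (ii): "all isomorphisms"), then an element of `Π_{M^Θ_{M'}}` whose transition lies in
`Π_μ(M^Θ_M)` already lies in `Π_μ(M^Θ_{M'})`. [claim: Mochizuki2012, status: disputed]
[cite: Mochizuki2012, Prop 1.5 (iii) p.29] -/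
theorem mem_extCyc_of_trans_mem_extCyc {M M' : ℕ+} (h : (M : ℕ) ∣ (M' : ℕ))
    (hinjX : Function.Injective (Sys.transX h)) {z : (Sys.env M').Pi}
    (hz : Sys.trans h z ∈ (Sys.recon M).extCyc) : z ∈ (Sys.recon M').extCyc := by
  rw [Reconstruction.extCyc, MonoidHom.mem_ker] at hz ⊢
  apply (Sys.recon M').inclY_isOpenEmbedding.injective
  apply hinjX
  rw [Sys.transX_compat h z, hz, map_one, map_one, map_one]

/-- **IUTchII:Prop1.5(iii)** (kurims p. 29, "determines a projective limit exterior cyclotome `Π_μ(M^Θ_*)`") with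
**Def2.7(i)** (p. 81, "whose kernel may be identified with the exterior cyclotome"): with surjective transitions
and injective `Π_X`-transitions, the limit exterior cyclotome `Π_μ(M^Θ_*) = extCycLim` maps ONTO `Π_μ(M^Θ_{M₀})`
for every `M₀` — the member-`M₀` image of `extCycLim` IS `(Sys.recon M₀).extCyc`. PROVED (lift `a` to a
compatible family by the Mittag-Leffler step; its member at `M₀·M` dies in `Π_Y` by injectivity of the
`Π_X`-transition, hence so does its member at `M`). [claim: Mochizuki2012, status: disputed]
[cite: Mochizuki2012, Prop 1.5 (iii) p.29] -/
theorem map_eval_extCycLim_eq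
    (hsurj : ∀ {M M' : ℕ+} (h : (M : ℕ) ∣ (M' : ℕ)), Function.Surjective (Sys.trans h))
    (hinjX : ∀ {M M' : ℕ+} (h : (M : ℕ) ∣ (M' : ℕ)), Function.Injective (Sys.transX h)) (M₀ : ℕ+) :
    Sys.extCycLim.map (Pi.evalMonoidHom (fun N : ℕ+ => (Sys.env N).Pi) M₀) = (Sys.recon M₀).extCyc := by
  apply le_antisymm
  · rintro _ ⟨x, ⟨hx, -⟩, rfl⟩
    exact hx M₀
  · intro a ha
    obtain ⟨x, hx, hxa⟩ := Sys.exists_compatible_eq hsurj M₀ a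
    refine ⟨x, ⟨fun M => ?_, hx⟩, hxa⟩
    -- pass through the common multiple `M · M₀`
    have hM : (M : ℕ) ∣ ((M * M₀ : ℕ+) : ℕ) := by
      rw [PNat.mul_coe]; exact dvd_mul_right _ _
    have hM₀ : (M₀ : ℕ) ∣ ((M * M₀ : ℕ+) : ℕ) := by
      rw [PNat.mul_coe]; exact dvd_mul_left _ _
    have hbig : x (M * M₀) ∈ (Sys.recon (M * M₀)).extCyc := by
      apply Sys.mem_extCyc_of_trans_mem_extCyc hM₀ (hinjX hM₀)
      rw [hx M₀ (M * M₀) hM₀, hxa]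
      exact ha
    rw [← hx M (M * M₀) hM]
    exact Sys.trans_mem_extCyc hM hbig

/-- **IUTchII:Prop1.5(iii)** under the hypotheses of record: `IsMonoThetaCompatible R` (REPAIRED Prop. 1.5 (i);
surjective transitions BY NAME) and the first clause of `transitionsAreIsos` (Prop. 1.5 (ii), bijective
`Π_X`-transitions): `Π_μ(M^Θ_*) ↠ Π_μ(M^Θ_{M₀})` for every `M₀`. [claim: Mochizuki2012, status: disputed]
[cite: Mochizuki2012, Prop 1.5 (iii) p.29] -/
theorem map_eval_extCycLim_eq_of_isMonoThetaCompatible (R : F.Reductions)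
    (hSys : Sys.IsMonoThetaCompatible R) (hX : Sys.transitionsAreIsos) (M₀ : ℕ+) :
    Sys.extCycLim.map (Pi.evalMonoidHom (fun N : ℕ+ => (Sys.env N).Pi) M₀) = (Sys.recon M₀).extCyc :=
  Sys.map_eval_extCycLim_eq (fun h => trans_surjective_of_isMonoThetaCompatible R Sys hSys h)
    (fun h => (hX.1 h).1.injective) M₀

/-- **IUTchII:Def2.7(i)** / **Prop1.5(iii)** (kurims p. 81 / p. 29): with surjective transitions the limit
`Π_{M^Θ_*}` surjects onto EVERY member `Π_{M^Θ_{M₀}}` — restated on the subgroup of compatible families for an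
arbitrary index (the case `M₀ = 1` is the Def. 2.7 (i) image clause). [claim: Mochizuki2012, status: disputed]
[cite: Mochizuki2012, Def 2.7 (i) p.81] -/
theorem evalCompatible_surjective_of_isMonoThetaCompatible (R : F.Reductions)
    (hSys : Sys.IsMonoThetaCompatible R) (M₀ : ℕ+) :
    Function.Surjective
      ((Pi.evalMonoidHom (fun N : ℕ+ => (Sys.env N).Pi) M₀).comp
        (Subgroup.subtype
          (⨅ (M : ℕ+) (M' : ℕ+) (hd : (M : ℕ) ∣ (M' : ℕ)),
            MonoidHom.eqLocus ((Sys.trans hd).comp (Pi.evalMonoidHom (fun N : ℕ+ => (Sys.env N).Pi) M'))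
              (Pi.evalMonoidHom (fun N : ℕ+ => (Sys.env N).Pi) M) :
                Subgroup (∀ N : ℕ+, (Sys.env N).Pi)))) :=
  Sys.evalCompatible_surjective (fun h => trans_surjective_of_isMonoThetaCompatible R Sys hSys h) M₀

end MonoThetaProjSystem

end Literature.IUT.HodgeArakelov
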